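import Mathlib
import HarnessLib
import Summits.ValiantsHypothesis.ValiantsHypothesis.Theorems.LacunarySymmetroidMatrixDescartesProductPlusOneMixedSigned
import Summits.ValiantsHypothesis.ValiantsHypothesis.Theorems.LacunarySymmetroidMatrixDescartesProductPlusOneTameKCalculus
import Summits.ValiantsHypothesis.ValiantsHypothesis.Theorems.LacunarySymmetroidMatrixDescartesCensusLaguerreSum

/-!
# ValiantsHypothesis / LacunarySymmetroid — crux `MatrixDescartes` (stmt-ValiantsHypothesis-18050, V1),
# LINE (A) «product_plus_one»: the TAME SECTOR, EVERY `K` — MEMBERS, SIGN-AWARE: `Z₊ ≤ #{sign-changing factors} + 2`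

On `…TameKCalculus` (`hasDerivAt_tameXi`) and p7 g14's gap parity (✓ `card_pos_roots_le_countP_add_two`), as in ✓ `…LowerSignedMembers`:
`tame_countP_pos_roots_le_one` (a tame coefficient sequence has two weak sign blocks: ✓ `Census.signVariations_succ_le_of_blocks` + Mathlib's
`roots_countP_pos_le_signVariations`), `tame_countP_pos_roots_eq_zero`, ★ `tameK_sector_pos_roots_signed` (range-indexed, tame window:
`Z₊(κ X^{m d_0} + ∏ f_j) ≤ S + 2`, `S` = number of SIGN-CHANGING factors), ★★ `tameK_sector_classK_signed` (LINE SHAPE, every `K ≥ 2`, tame window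
`d_{K−1} − d_0 ≤ 4(d_1 − d_0)`, bottom coupling: `Z₊ ≤ #{j : ∃ l ≥ 1, a j 0 · a j l < 0} + 2 ≤ m + 2`), `classRowK3_tameWeak_signed` (the `K = 3` row:
p5 g13's ✓ `tame_sector_class_signed` constant under the weak tame hypotheses, refined to `#{j : a_{j0}a_{j1} < 0 ∨ a_{j0}a_{j2} < 0} + 2`).
HONEST FRAMING: a sector constant; NOT `stub_classRowK3` / `stub_polyLaw` / `MatrixDescartes` / Conjecture B; `VP ≠ VNP` is NOT proved.
No definitions, no named facts.
-/

set_option linter.dupNamespace false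

namespace Summit.ValiantsHypothesis.ValiantsHypothesis.Theorems.LacunarySymmetroidMatrixDescartes

namespace ProductPlusOne

open Polynomial Finset
open scoped BigOperators

/-- A TAME sparse factor (`c_0 ≠ 0`, `c_1` free, `c_0 c_i ≤ 0` for `i ≥ 2`) has at most ONE positive zero counted WITH multiplicity: its
coefficient sequence has two weak sign blocks. [folklore] -/
theorem tame_countP_pos_roots_le_one (T : ℕ) (d : ℕ → ℕ) (hd : StrictMono d) (c : ℕ → ℝ)
    (ht : (0 < c 0 ∧ ∀ i, 2 ≤ i → i < T + 2 → c i ≤ 0) ∨ (c 0 < 0 ∧ ∀ i, 2 ≤ i → i < T + 2 → 0 ≤ c i)) :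
    (∑ i ∈ Finset.range (T + 2), C (c i) * X ^ (d i) : ℝ[X]).roots.countP (fun t => 0 < t) ≤ 1 := by
  classical
  have hd01 : d 0 < d 1 := hd (by omega)
  have key : ∀ c' : ℕ → ℝ, 0 < c' 0 → (∀ i, 2 ≤ i → i < T + 2 → c' i ≤ 0) →
      (∑ i ∈ Finset.range (T + 2), C (c' i) * X ^ (d i) : ℝ[X]).roots.countP (fun t => 0 < t) ≤ 1 := by
    intro c' h0 hup
    set f : ℝ[X] := ∑ i ∈ Finset.range (T + 2), C (c' i) * X ^ (d i) with hfdef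
    refine (roots_countP_pos_le_signVariations _).trans ?_
    have hcoeff : ∀ k, f.coeff k = ∑ i ∈ Finset.range (T + 2), (if k = d i then c' i else 0) := by
      intro k
      rw [hfdef, finsetSum_coeff]
      exact Finset.sum_congr rfl fun i _ => by rw [coeff_C_mul_X_pow]
    -- the cut between the nonnegative and the nonpositive block
    set cut : ℕ := if 0 ≤ c' 1 then d 1 + 1 else d 0 + 1 with hcut
    have hcut0 : d 0 < cut := by rw [hcut]; split_ifs <;> omega
    have hcut1 : cut ≤ d 1 + 1 := by rw [hcut]; split_ifs <;> omega
    set bl : ℕ → ℕ := fun k => if k = 0 then 0 else if k = 1 then cut else f.natDegree + 1 + cut with hbl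
    have hV := Census.signVariations_succ_le_of_blocks 2 f bl (by simp [hbl]) ?_ ?_ ?_
    · omega
    · refine monotone_nat_of_le_succ fun k => ?_
      rcases Nat.lt_or_ge k 2 with hk | hk
      · interval_cases k <;> simp [hbl]
      · simp only [hbl, if_neg (show k ≠ 0 by omega), if_neg (show k ≠ 1 by omega), if_neg (show k + 1 ≠ 0 by omega),
          if_neg (show k + 1 ≠ 1 by omega), le_refl]
    · show f.natDegree < bl 2
      simp only [hbl, show (2:ℕ) ≠ 0 by norm_num, show (2:ℕ) ≠ 1 by norm_num, if_false]
      omega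
    · intro i hi
      interval_cases i
      · -- block 0: degrees < cut carry `c' 0 > 0` and (if `c' 1 ≥ 0`) `c' 1`
        refine ⟨1, Or.inl rfl, fun k _ hk => ?_⟩
        have hk' : k < cut := by simpa [hbl] using hk
        rw [one_mul, hcoeff]
        refine Finset.sum_nonneg fun j hj => ?_
        split_ifs with hkj
        · rcases Nat.lt_or_ge j 2 with hj2 | hj2
          · interval_cases j
            · exact h0.le
            · -- `k = d 1 < cut` forces `cut = d 1 + 1`, i.e. `0 ≤ c' 1`
              by_contra hneg
              push Not at hneg
              have : cut = d 0 + 1 := by rw [hcut, if_neg (not_le.2 hneg)]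
              omega
          · exfalso
            have : d 1 < d j := hd (by omega)
            omega
        · exact le_rfl
      · -- block 1: degrees ≥ cut carry `c' i ≤ 0` (`i ≥ 2`) and (if `c' 1 < 0`) `c' 1`
        refine ⟨-1, Or.inr rfl, fun k hk _ => ?_⟩
        have hk' : cut ≤ k := by simpa [hbl] using hk
        rw [hcoeff, neg_one_mul, neg_nonneg]
        refine Finset.sum_nonpos fun j hj => ?_
        split_ifs with hkj
        · rcases Nat.lt_or_ge j 2 with hj2 | hj2
          · interval_cases j
            · exfalso; omega
            · -- `k = d 1 ≥ cut` forces `cut = d 0 + 1`, i.e. `c' 1 < 0`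
              by_contra hpos
              push Not at hpos
              have hneg : ¬ (0 ≤ c' 1) := fun h => by
                have : cut = d 1 + 1 := by rw [hcut, if_pos h]
                omega
              exact hneg hpos.le
          · exact hup j hj2 (Finset.mem_range.1 hj)
        · exact le_rfl
  rcases ht with ⟨h0, hup⟩ | ⟨h0, hup⟩
  · exact key c h0 hup
  · have e1 : (∑ i ∈ Finset.range (T + 2), C (c i) * X ^ (d i) : ℝ[X])
        = -(∑ i ∈ Finset.range (T + 2), C ((fun i => -c i) i) * X ^ (d i)) := by
      rw [← Finset.sum_neg_distrib]; exact Finset.sum_congr rfl fun i _ => by simp only [map_neg, neg_mul, neg_neg]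
    rw [e1, roots_neg]
    exact key (fun i => -c i) (by simpa using h0) (fun i hi hiT => by simpa using hup i hi hiT)

/-- A tame factor WITHOUT a coefficient strictly opposite in sign to the bottom one has NO positive zero. [folklore] -/
theorem tame_countP_pos_roots_eq_zero (T : ℕ) (d : ℕ → ℕ) (hd : StrictMono d) (c : ℕ → ℝ)
    (ht : (0 < c 0 ∧ ∀ i, 2 ≤ i → i < T + 2 → c i ≤ 0) ∨ (c 0 < 0 ∧ ∀ i, 2 ≤ i → i < T + 2 → 0 ≤ c i))
    (hns : ∀ i, 1 ≤ i → i < T + 2 → 0 ≤ c 0 * c i) :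
    (∑ i ∈ Finset.range (T + 2), C (c i) * X ^ (d i) : ℝ[X]).roots.countP (fun t => 0 < t) = 0 := by
  classical
  have key : ∀ c' : ℕ → ℝ, (∀ i, i < T + 2 → 0 ≤ c' i) →
      (∑ i ∈ Finset.range (T + 2), C (c' i) * X ^ (d i) : ℝ[X]).roots.countP (fun t => 0 < t) = 0 := by
    intro c' hnn
    have hV : (∑ i ∈ Finset.range (T + 2), C (c' i) * X ^ (d i) : ℝ[X]).signVariations = 0 := by
      refine signVariations_eq_zero_of_coeff_nonneg _ _ le_rfl (fun k => ?_)
      rw [finsetSum_coeff]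
      refine Finset.sum_nonneg (fun i hi => ?_)
      rw [coeff_C_mul_X_pow]
      split_ifs; exacts [hnn i (Finset.mem_range.mp hi), le_rfl]
    exact Nat.le_zero.mp (hV ▸ roots_countP_pos_le_signVariations (∑ i ∈ Finset.range (T + 2), C (c' i) * X ^ (d i) : ℝ[X]))
  have _ := hd
  rcases ht with ⟨h0, hup⟩ | ⟨h0, hup⟩
  · refine key c fun i hi => ?_
    rcases Nat.eq_zero_or_pos i with h | h
    · rw [h]; exact h0.le
    · have := hns i h hi; nlinarith
  · have e1 : (∑ i ∈ Finset.range (T + 2), C (c i) * X ^ (d i) : ℝ[X])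
        = -(∑ i ∈ Finset.range (T + 2), C ((fun i => -c i) i) * X ^ (d i)) := by
      rw [← Finset.sum_neg_distrib]; exact Finset.sum_congr rfl fun i _ => by simp only [map_neg, neg_mul, neg_neg]
    rw [e1, roots_neg]
    refine key (fun i => -c i) fun i hi => ?_
    rcases Nat.eq_zero_or_pos i with h | h
    · rw [h]; show 0 ≤ -c 0; linarith
    · have := hns i h hi; show 0 ≤ -c i; nlinarith

/-- ★ **THE TAME SECTOR, MEMBERS, SIGN-AWARE** (range-indexed; tame window `d_{T+1} − d_0 ≤ 4(d_1 − d_0)`, bottom coupling `N = m·d_0`):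
`Z₊(κ X^{m d_0} + ∏_j f_j) ≤ S + 2`, `S` = the number of SIGN-CHANGING factors (some coefficient strictly opposite in sign to the bottom one). -/
theorem tameK_sector_pos_roots_signed {m : ℕ} (T : ℕ) (d : ℕ → ℕ) (hd : StrictMono d) (hwin : d (T + 1) - d 0 ≤ 4 * (d 1 - d 0))
    (c : Fin m → ℕ → ℝ)
    (ht : ∀ j, (0 < c j 0 ∧ ∀ i, 2 ≤ i → i < T + 2 → c j i ≤ 0) ∨ (c j 0 < 0 ∧ ∀ i, 2 ≤ i → i < T + 2 → 0 ≤ c j i)) (κ : ℝ) :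
    ((C κ * X ^ (m * d 0) + ∏ j, (∑ i ∈ Finset.range (T + 2), C (c j i) * X ^ (d i) : ℝ[X])).roots.toFinset.filter
      (fun t => 0 < t)).card ≤ (Finset.univ.filter (fun j => ∃ i, i < T + 2 ∧ 1 ≤ i ∧ c j 0 * c j i < 0)).card + 2 := by
  classical
  set S := (Finset.univ.filter (fun j : Fin m => ∃ i, i < T + 2 ∧ 1 ≤ i ∧ c j 0 * c j i < 0)).card with hSdef
  set P : ℝ[X] := ∏ j, (∑ i ∈ Finset.range (T + 2), C (c j i) * X ^ (d i) : ℝ[X]) with hPdef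
  -- no positive zero of a polynomial of the form `C a * X^n`
  have hmono0 : ∀ (a : ℝ) (n : ℕ), ((C a * X ^ n : ℝ[X]).roots.toFinset.filter (fun t => 0 < t)).card = 0 := by
    intro a n
    by_cases ha : a = 0
    · rw [ha]; simp
    rw [roots_C_mul_X_pow ha, Finset.card_eq_zero]
    ext t
    simp only [Finset.mem_filter, Multiset.mem_toFinset, Multiset.mem_nsmul, Multiset.mem_singleton,
      Finset.notMem_empty, iff_false, not_and, not_lt]
    rintro ⟨_, rfl⟩; exact le_rfl
  -- a vanishing product
  by_cases hP0 : P = 0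
  · rw [hP0, add_zero, hmono0]; exact Nat.zero_le _
  have hne : ∀ j, (∑ i ∈ Finset.range (T + 2), C (c j i) * X ^ (d i) : ℝ[X]) ≠ 0 := by
    intro j h
    apply hP0
    exact Finset.prod_eq_zero (Finset.mem_univ j) h
  -- multiplicity of the positive zeros of P: ≤ S
  have hone : ∀ j, ((∑ i ∈ Finset.range (T + 2), C (c j i) * X ^ (d i) : ℝ[X])).roots.countP (fun t => 0 < t)
      ≤ if (∃ i, i < T + 2 ∧ 1 ≤ i ∧ c j 0 * c j i < 0) then 1 else 0 := by
    intro j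
    split_ifs with hsc
    · exact tame_countP_pos_roots_le_one T d hd (c j) (ht j)
    · push Not at hsc
      exact (tame_countP_pos_roots_eq_zero T d hd (c j) (ht j) (fun i hi1 hiT => hsc i hiT hi1)).le
  have hmult : P.roots.countP (fun t => 0 < t) ≤ S := by
    have key : ∀ s : Finset (Fin m),
        (∏ j ∈ s, (∑ i ∈ Finset.range (T + 2), C (c j i) * X ^ (d i) : ℝ[X])).roots.countP (fun t => 0 < t)
          ≤ ∑ j ∈ s, (if (∃ i, i < T + 2 ∧ 1 ≤ i ∧ c j 0 * c j i < 0) then 1 else 0) := by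
      intro s
      induction s using Finset.induction_on with
      | empty => simp
      | @insert a s ha ih =>
        rw [Finset.prod_insert ha, roots_mul (mul_ne_zero (hne a) (Finset.prod_ne_zero_iff.mpr (fun j _ => hne j))),
          Multiset.countP_add, Finset.sum_insert ha]
        have h1 := hone a
        omega
    simpa only [hSdef, Finset.card_filter] using key Finset.univ
  by_cases hκ : κ = 0
  · subst hκ
    rw [map_zero, zero_mul, zero_add]
    exact ((StubVLawTwo.card_filter_pos_le_countP P).trans hmult).trans (by omega)
  -- every factor a bottom monomial: the member is a monomial
  by_cases hdeg : ∃ j, ∃ i, 1 ≤ i ∧ i < T + 2 ∧ c j i ≠ 0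
  swap
  · push Not at hdeg
    have hfac : ∀ j, (∑ i ∈ Finset.range (T + 2), C (c j i) * X ^ (d i) : ℝ[X]) = C (c j 0) * X ^ (d 0) := by
      intro j
      rw [Finset.sum_range_succ']
      have : ∑ i ∈ Finset.range (T + 1), C (c j (i + 1)) * X ^ (d (i + 1)) = (0 : ℝ[X]) :=
        Finset.sum_eq_zero fun i hi => by
          rw [hdeg j (i + 1) (by omega) (by have := Finset.mem_range.1 hi; omega)]; simp
      rw [this, zero_add]
    have hP : P = C (∏ j, c j 0) * X ^ (m * d 0) := by
      rw [hPdef, Finset.prod_congr rfl (fun j _ => hfac j), Finset.prod_mul_distrib, map_prod C, Finset.prod_const,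
        Finset.card_univ, Fintype.card_fin, ← pow_mul]
      ring_nf
    have : C κ * X ^ (m * d 0) + P = C (κ + ∏ j, c j 0) * X ^ (m * d 0) := by rw [hP, map_add]; ring
    rw [this, hmono0]; exact Nat.zero_le _
  obtain ⟨j₀, i₀, hi₀0, hi₀T, hci₀⟩ := hdeg
  have hmain := card_pos_roots_le_countP_add_two P hP0 κ hκ (m * d 0) ?_
  · exact hmain.trans (by omega)
  -- no three member zeros in a zero-free interval of P
  intro z₁ hz₁ z₂ hz₂ z₃ hz₃ h12 h23 free13
  have hSmem : ∀ z ∈ (C κ * X ^ (m * d 0) + P).roots.toFinset.filter (fun t => 0 < t),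
      0 < z ∧ eval z (C κ * X ^ (m * d 0) + P) = 0 := by
    intro z hz
    rw [mem_filter, Multiset.mem_toFinset] at hz
    by_cases h0 : C κ * X ^ (m * d 0) + P = 0
    · rw [h0, roots_zero] at hz
      exact absurd hz.1 (Multiset.notMem_zero _)
    · exact ⟨hz.2, (IsRoot.def).mp ((mem_roots h0).mp hz.1)⟩
  have hfacne : ∀ t, eval t P ≠ 0 → ∀ j, (∑ i ∈ Finset.range (T + 2), C (c j i) * X ^ (d i) : ℝ[X]).eval t ≠ 0 := by
    intro t hPt j hj
    apply hPt
    rw [hPdef, eval_prod, Finset.prod_eq_zero_iff]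
    exact ⟨j, mem_univ _, hj⟩
  have hz₁pos := (hSmem z₁ hz₁).1
  obtain ⟨w₁, hw₁, hd₁⟩ := exists_root_euler_between (C κ * X ^ (m * d 0) + P) (m * d 0) hz₁pos h12 (hSmem z₁ hz₁).2 (hSmem z₂ hz₂).2
  obtain ⟨w₂, hw₂, hd₂⟩ :=
    exists_root_euler_between (C κ * X ^ (m * d 0) + P) (m * d 0) (hz₁pos.trans h12) h23 (hSmem z₂ hz₂).2 (hSmem z₃ hz₃).2
  have hw₁pos : 0 < w₁ := hz₁pos.trans hw₁.1
  have hw₁₂ : w₁ < w₂ := hw₁.2.trans hw₂.1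
  have hIcc : Set.Icc w₁ w₂ ⊆ Set.Icc z₁ z₃ := fun t ht => ⟨hw₁.1.le.trans ht.1, ht.2.trans hw₂.2.le⟩
  have hfree : ∀ t ∈ Set.Icc w₁ w₂, ∀ j, (∑ i ∈ Finset.range (T + 2), C (c j i) * X ^ (d i) : ℝ[X]).eval t ≠ 0 :=
    fun t ht j => hfacne t (free13 t (hIcc ht)) j
  -- level condition at a zero of X h′ − N h off the zeros of P
  have hlevelΦ : ∀ w : ℝ, 0 < w → eval w P ≠ 0 →
      eval w (X * derivative (C κ * X ^ (m * d 0) + P) - C ((m * d 0 : ℕ) : ℝ) * (C κ * X ^ (m * d 0) + P)) = 0 →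
      (∑ j, w * (derivative (∑ i ∈ Finset.range (T + 2), C (c j i) * X ^ (d i) : ℝ[X])).eval w
          / (∑ i ∈ Finset.range (T + 2), C (c j i) * X ^ (d i) : ℝ[X]).eval w) = (m : ℝ) * (d 0 : ℝ) := by
    intro w hw hPw hd0
    have hE : X * derivative (C κ * X ^ (m * d 0) + P) - C ((m * d 0 : ℕ) : ℝ) * (C κ * X ^ (m * d 0) + P)
        = X * derivative P - C ((m * d 0 : ℕ) : ℝ) * P := by
      have h := euler_sub_monomial P (-κ) (m * d 0)
      rw [map_neg] at h
      rw [show C κ * X ^ (m * d 0) + P = P - -C κ * X ^ (m * d 0) by ring]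
      exact h
    rw [hE, eval_sub, eval_mul, eval_X, eval_mul, eval_C, hPdef,
      eval_euler_prod_general _ (hfacne w hPw), ← eval_prod] at hd0
    rw [hPdef] at hPw
    have : eval w (∏ j, (∑ i ∈ Finset.range (T + 2), C (c j i) * X ^ (d i) : ℝ[X])) *
        ((∑ j, w * (derivative (∑ i ∈ Finset.range (T + 2), C (c j i) * X ^ (d i) : ℝ[X])).eval w
          / (∑ i ∈ Finset.range (T + 2), C (c j i) * X ^ (d i) : ℝ[X]).eval w) - (m : ℝ) * (d 0 : ℝ)) = 0 := by
      rw [mul_sub]; push_cast at hd0; linarith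
    rcases mul_eq_zero.mp this with h1 | h1
    · exact absurd h1 hPw
    linarith
  have h1 := hlevelΦ w₁ hw₁pos (free13 w₁ (hIcc ⟨le_rfl, hw₁₂.le⟩)) hd₁
  have h2 := hlevelΦ w₂ (hw₁pos.trans hw₁₂) (free13 w₂ (hIcc ⟨hw₁₂.le, le_rfl⟩)) hd₂
  -- the top-chart weighted level function Ξ and Rolle
  set Ξ : ℝ → ℝ := fun y => ∑ j, (X * derivative (∑ i ∈ Finset.range (T + 2), C (c j i) * X ^ (d i) : ℝ[X])
      - C ((d 0 : ℕ) : ℝ) * ∑ i ∈ Finset.range (T + 2), C (c j i) * X ^ (d i)).eval y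
      / (y ^ (d 1 - d 0) * (∑ i ∈ Finset.range (T + 2), C (c j i) * X ^ (d i) : ℝ[X]).eval y) with hΞ
  have hlevel : ∀ y : ℝ, 0 < y → (∀ j, (∑ i ∈ Finset.range (T + 2), C (c j i) * X ^ (d i) : ℝ[X]).eval y ≠ 0) →
      (∑ j, y * (derivative (∑ i ∈ Finset.range (T + 2), C (c j i) * X ^ (d i) : ℝ[X])).eval y
          / (∑ i ∈ Finset.range (T + 2), C (c j i) * X ^ (d i) : ℝ[X]).eval y) = (m : ℝ) * (d 0 : ℝ) →
      Ξ y = 0 := by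
    intro y hy hfy hl
    have hyw : y ^ (d 1 - d 0) ≠ 0 := pow_ne_zero _ hy.ne'
    have key : Ξ y * y ^ (d 1 - d 0)
        = (∑ j, y * (derivative (∑ i ∈ Finset.range (T + 2), C (c j i) * X ^ (d i) : ℝ[X])).eval y
          / (∑ i ∈ Finset.range (T + 2), C (c j i) * X ^ (d i) : ℝ[X]).eval y) - (m : ℝ) * (d 0 : ℝ) := by
      rw [hΞ]; simp only
      rw [Finset.sum_mul]
      have : ((m : ℝ) * (d 0 : ℝ)) = ∑ _j : Fin m, ((d 0 : ℕ) : ℝ) := by simp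
      rw [this, ← Finset.sum_sub_distrib]
      refine Finset.sum_congr rfl fun j _ => ?_
      have hfj := hfy j
      simp only [eval_sub, eval_mul, eval_X, eval_C]
      field_simp
    rw [hl, sub_self] at key
    exact (mul_eq_zero.1 key).resolve_right hyw
  have hΞ1 : Ξ w₁ = 0 := hlevel w₁ hw₁pos (hfree w₁ ⟨le_rfl, hw₁₂.le⟩) h1
  have hΞ2 : Ξ w₂ = 0 := hlevel w₂ (hw₁pos.trans hw₁₂) (hfree w₂ ⟨hw₁₂.le, le_rfl⟩) h2
  have hm : 0 < m := Fin.pos j₀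
  have hderiv : ∀ t ∈ Set.Icc w₁ w₂, ∃ D : ℝ, D < 0 ∧ HasDerivAt Ξ D t := by
    intro t htI
    have ht0 : 0 < t := hw₁pos.trans_le htI.1
    choose D hD using fun j => hasDerivAt_tameXi T d hd hwin (c j) (ht j) ht0 (hfree t htI j)
    refine ⟨∑ j, D j, ?_, ?_⟩
    · calc ∑ j, D j < ∑ _j : Fin m, (0 : ℝ) :=
          Finset.sum_lt_sum (fun j _ => (hD j).1) ⟨j₀, Finset.mem_univ _, (hD j₀).2.1 ⟨i₀, hi₀0, hi₀T, hci₀⟩⟩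
        _ = 0 := by simp
    · have := HasDerivAt.fun_sum (u := Finset.univ) (fun j _ => (hD j).2.2)
      rw [hΞ]; exact this
  have hcont : ContinuousOn Ξ (Set.Icc w₁ w₂) := fun t ht => (hderiv t ht).elim fun D hD => hD.2.continuousAt.continuousWithinAt
  obtain ⟨ξ, hξ, hξ'⟩ := exists_deriv_eq_zero hw₁₂ hcont (hΞ1.trans hΞ2.symm)
  obtain ⟨D, hDneg, hD⟩ := hderiv ξ ⟨hξ.1.le, hξ.2.le⟩
  exact hDneg.ne (hD.deriv ▸ hξ')

/-- ★★ **THE TAME SECTOR, EVERY FORMAT, MEMBERS, SIGN-AWARE — line shape** (`2 ≤ K`, tame window, bottom coupling `l₀ = 0`):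
`Z₊(C c·X^{m d_0} + ∏ f_j) ≤ #{j : ∃ l ≥ 1, a j 0 · a j l < 0} + 2` (so `≤ m + 2`). [this file's theorem] -/
theorem tameK_sector_classK_signed {m K : ℕ} (hK : 2 ≤ K) (d : Fin K → ℕ) (hd : StrictMono d)
    (hwin : d ⟨K - 1, by omega⟩ - d ⟨0, by omega⟩ ≤ 4 * (d ⟨1, by omega⟩ - d ⟨0, by omega⟩)) (a : Fin m → Fin K → ℝ)
    (ht : ∀ j, (0 < a j ⟨0, by omega⟩ ∧ ∀ l : Fin K, 2 ≤ (l : ℕ) → a j l ≤ 0) ∨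
      (a j ⟨0, by omega⟩ < 0 ∧ ∀ l : Fin K, 2 ≤ (l : ℕ) → 0 ≤ a j l)) (c : ℝ) :
    ((C c * X ^ (m * d ⟨0, by omega⟩) + ∏ j, ∑ l, C (a j l) * X ^ (d l) : ℝ[X]).roots.toFinset.filter
      (fun t => 0 < t)).card
      ≤ (Finset.univ.filter (fun j => ∃ l : Fin K, 1 ≤ (l : ℕ) ∧ a j ⟨0, by omega⟩ * a j l < 0)).card + 2 := by
  classical
  obtain ⟨K', rfl⟩ : ∃ K', K = K' + 2 := ⟨K - 2, by omega⟩
  set dx : ℕ → ℕ := fun i => if h : i < K' + 2 then d ⟨i, h⟩ else d ⟨K' + 1, by omega⟩ + (i - (K' + 1)) with hdx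
  set cx : Fin m → ℕ → ℝ := fun j i => if h : i < K' + 2 then a j ⟨i, h⟩ else 0 with hcx
  have hdx_in : ∀ i (h : i < K' + 2), dx i = d ⟨i, h⟩ := fun i h => by simp only [hdx]; exact dif_pos h
  have hcx_in : ∀ j i (h : i < K' + 2), cx j i = a j ⟨i, h⟩ := fun j i h => by simp only [hcx]; exact dif_pos h
  have hdmono : StrictMono dx := by
    intro i j hij
    by_cases hj : j < K' + 2
    · have hi : i < K' + 2 := by omega
      rw [hdx_in i hi, hdx_in j hj]
      exact hd (Fin.mk_lt_mk.mpr hij)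
    · have ej : dx j = d ⟨K' + 1, by omega⟩ + (j - (K' + 1)) := by simp only [hdx]; exact dif_neg hj
      rw [ej]
      by_cases hi : i < K' + 2
      · rw [hdx_in i hi]
        have : d ⟨i, hi⟩ ≤ d ⟨K' + 1, by omega⟩ := hd.monotone (Fin.mk_le_mk.mpr (by omega))
        omega
      · have ei : dx i = d ⟨K' + 1, by omega⟩ + (i - (K' + 1)) := by simp only [hdx]; exact dif_neg hi
        rw [ei]
        omega
  have hfac : ∀ j, (∑ l, C (a j l) * X ^ (d l) : ℝ[X]) = ∑ i ∈ Finset.range (K' + 2), C (cx j i) * X ^ (dx i) := by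
    intro j
    rw [← Fin.sum_univ_eq_sum_range (fun i => C (cx j i) * X ^ (dx i)) (K' + 2)]
    refine Finset.sum_congr rfl (fun l _ => ?_)
    have hl : (l : ℕ) < K' + 2 := l.isLt
    simp only [hcx, hdx, dif_pos hl, Fin.eta]
  have ht' : ∀ j, (0 < cx j 0 ∧ ∀ i, 2 ≤ i → i < K' + 2 → cx j i ≤ 0) ∨ (cx j 0 < 0 ∧ ∀ i, 2 ≤ i → i < K' + 2 → 0 ≤ cx j i) := by
    intro j
    rcases ht j with ⟨h0, h⟩ | ⟨h0, h⟩
    · refine Or.inl ⟨by rw [hcx_in j 0 (by omega)]; exact h0, fun i hi hiK => ?_⟩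
      rw [hcx_in j i hiK]
      exact h ⟨i, hiK⟩ (by simpa using hi)
    · refine Or.inr ⟨by rw [hcx_in j 0 (by omega)]; exact h0, fun i hi hiK => ?_⟩
      rw [hcx_in j i hiK]
      exact h ⟨i, hiK⟩ (by simpa using hi)
  have hwin' : dx (K' + 1) - dx 0 ≤ 4 * (dx 1 - dx 0) := by
    rw [hdx_in (K' + 1) (by omega), hdx_in 0 (by omega), hdx_in 1 (by omega)]
    have e : (⟨K' + 2 - 1, by omega⟩ : Fin (K' + 2)) = ⟨K' + 1, by omega⟩ := by ext; simp
    rw [e] at hwin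
    exact hwin
  -- the sign-changing sets coincide
  have hS : (Finset.univ.filter (fun j => ∃ i, i < K' + 2 ∧ 1 ≤ i ∧ cx j 0 * cx j i < 0))
      = Finset.univ.filter (fun j => ∃ l : Fin (K' + 2), 1 ≤ (l : ℕ) ∧ a j ⟨0, by omega⟩ * a j l < 0) := by
    refine Finset.filter_congr (fun j _ => ?_)
    constructor
    · rintro ⟨i, hiK, hi1, hlt⟩
      refine ⟨⟨i, hiK⟩, by simpa using hi1, ?_⟩
      rw [hcx_in j 0 (by omega), hcx_in j i hiK] at hlt
      exact hlt
    · rintro ⟨l, hl, hlt⟩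
      refine ⟨l, l.isLt, hl, ?_⟩
      rw [hcx_in j 0 (by omega), hcx_in j l l.isLt]
      simpa using hlt
  rw [Finset.prod_congr rfl (fun j _ => hfac j)]
  have h0 : d ⟨0, by omega⟩ = dx 0 := by rw [hdx_in 0 (by omega)]
  rw [h0, ← hS]
  exact tameK_sector_pos_roots_signed K' dx hdmono hwin' cx ht' c

/-- **The `K = 3` row, members, sign-aware, weak tame hypotheses** (`d 2 − d 0 ≤ 4(d 1 − d 0)`, bottom coupling; `a_{j0} ≠ 0`, `a_{j2}` weakly
opposite, `a_{j1}` free): `Z₊(C c·X^{m d 0} + ∏ f_j) ≤ #{j : a_{j0} a_{j1} < 0 ∨ a_{j0} a_{j2} < 0} + 2` (so `≤ m + 2`, ✓ `tame_sector_class_signed`).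
[this file's theorem] -/
theorem classRowK3_tameWeak_signed {m : ℕ} (d : Fin 3 → ℕ) (h01 : d 0 < d 1) (h12 : d 1 < d 2) (hwin : d 2 - d 0 ≤ 4 * (d 1 - d 0))
    (a : Fin m → Fin 3 → ℝ) (ht : ∀ j, (0 < a j 0 ∧ a j 2 ≤ 0) ∨ (a j 0 < 0 ∧ 0 ≤ a j 2)) (c : ℝ) :
    ((C c * X ^ (m * d 0) + ∏ j, ∑ l, C (a j l) * X ^ (d l) : ℝ[X]).roots.toFinset.filter (fun t => 0 < t)).card
      ≤ (Finset.univ.filter (fun j => a j 0 * a j 1 < 0 ∨ a j 0 * a j 2 < 0)).card + 2 := by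
  classical
  have hd : StrictMono d := Fin.strictMono_iff_lt_succ.2 fun i => by fin_cases i <;> assumption
  have ht' : ∀ j, (0 < a j 0 ∧ ∀ l : Fin 3, 2 ≤ (l : ℕ) → a j l ≤ 0) ∨ (a j 0 < 0 ∧ ∀ l : Fin 3, 2 ≤ (l : ℕ) → 0 ≤ a j l) := by
    intro j
    rcases ht j with ⟨h0, h2⟩ | ⟨h0, h2⟩
    · exact Or.inl ⟨h0, fun l hl => by fin_cases l <;> simp at hl; exact h2⟩
    · exact Or.inr ⟨h0, fun l hl => by fin_cases l <;> simp at hl; exact h2⟩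
  have h := tameK_sector_classK_signed (by norm_num) d hd hwin a ht' c
  have hS : (Finset.univ.filter (fun j => ∃ l : Fin 3, 1 ≤ (l : ℕ) ∧ a j ⟨0, by omega⟩ * a j l < 0))
      = Finset.univ.filter (fun j => a j 0 * a j 1 < 0 ∨ a j 0 * a j 2 < 0) := by
    refine Finset.filter_congr (fun j _ => ?_)
    have e0 : (⟨0, by omega⟩ : Fin 3) = 0 := rfl
    rw [e0]
    constructor
    · rintro ⟨l, hl, hlt⟩
      fin_cases l
      · simp at hl
      exacts [Or.inl hlt, Or.inr hlt]
    · rintro (h | h)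
      exacts [⟨1, by simp, h⟩, ⟨2, by simp, h⟩]
  rw [hS] at h
  exact h

end ProductPlusOne

end Summit.ValiantsHypothesis.ValiantsHypothesis.Theorems.LacunarySymmetroidMatrixDescartes
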